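import Summits.FinalStateConjecture.FinalStateConjecture.Theorems.ErgoregionBombModT.Negative.AntecedentAnatomy
import Summits.FinalStateConjecture.FinalStateConjecture.Theorems.ZeroEnergyKerrOrBombErgoregionBombModTNonTrappingCertificate

/-!
# Promote kit — crux `ErgoregionBombModT` (stmt-FinalStateConjecture-17838), line `SketchIdeator4` (lead c7, cycle 2, 2026-08-17)

Copy-ready statements of the TWO candidate items the planner can promote to close the crux, with their kernel-checked closers
(`lean check`: rc 0, 0 sorries; everything referenced is LANDED):

* `ZF0` — the registered open stub `stub_zeroEnergyNullConvexFunction` verbatim (certificate form: a flow-invariant `C²` function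
  strictly convex along the non-zero zero-energy null directions over every compact `S` of the d.o.c., on a neighbourhood of its cage);
* `UniversalNonTrappingModT` (UNT_tel) — the WEAKEST statement closing the crux: no telescope hole has a zero-energy null geodesic
  trapped modulo the stationary flow (`¬ 𝓑.HasZeroEnergyRayTrappedModFlow` under the crux's telescope prefix verbatim, `[Kerr.Facts]`
  binder kept) = hypothesis h16 of `NonTrappingHawkingRigidity` (stmt-13896) quantified over the telescope
  (`StationaryAFBlackHole.not_hasZeroEnergyRayTrappedModFlow_iff` unfolds it to h16's text);
* `ErgoregionBombModT_of_UNT : UNT_tel → crux` — currying over the landed `Negative.ergoregionBombModT_iff` (p135428);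
* `universalNonTrappingModT_of_ZF0 : ZF0 → UNT_tel` — the landed certificate `nonTrapping_of_nullConvexFunction` (p164569), i.e. the
  X-free escape engine `stub_escapeEngineFree` (p163760);
* hence `crux ⇐ ZF0` factors as `ZF0 ⇒ UNT_tel ⇒ crux` (same content as the registered composition `ErgoregionBombModT_of`, p163760).

Planner's choice: promote UNT_tel if ONE shared item is wanted (it discharges 13896's h16 on every telescope hole and closes 17838 by
`ErgoregionBombModT_of_UNT`); promote ZF0 if the certificate form is wanted (the shape in which non-trapping is actually PROVED for a
concrete metric — Kerr: `F = e^{−μ r}`, Carter's sign `Kerr.hessAt_radius_neg_of_ksEnergy_eq_zero` + compactness; and the shape of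
Ionescu–Klainerman's `T`-conditional pseudo-convexity (HoCond2), Invent. Math. 175 (2009) §3.1).  Either way the bomb mechanism and the
Killing-mode-stability hypothesis of the target are idle on this line: its content is universal zero-energy non-trapping mod `T`
(Alexakis–Ionescu–Klainerman-conjecture grade; open).
-/

noncomputable section

open Bundle Set
open scoped Manifold Topology

set_option linter.dupNamespace false

namespace Summit.FinalStateConjecture.FinalStateConjecture.Cruxes.ErgoregionBombModT.ZeroEnergyEscape

open Literature.Geometry.Lorentzian

/-- ZF₀ (registered stub signature, verbatim). -/
def ZF0 : Prop :=
  ∀ (𝓑 : Literature.Geometry.Lorentzian.StationaryAFBlackHole.{0}) [𝓑.metric.HasLeviCivita] [Literature.Geometry.Lorentzian.Kerr.Facts], 𝓑.metric.toPseudoRiemannianMetric.IsRicciFlat → 𝓑.IsIPlusRegular → (∀ p : 𝓑.carrier, p ∈ 𝓑.metric.chronologicalFuture 𝓑.timeOrientation 𝓑.Mext) → (∀ p ∈ 𝓑.doc, 𝓑.killing p ≠ 0) → SimplyConnectedSpace 𝓑.doc → ∀ (U : Set 𝓑.carrier) (K : Π x : 𝓑.carrier, TangentSpace (𝓡 4)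 x), IsOpen U → 𝓑.horizon ⊆ U → IsConnected 𝓑.horizon → ContMDiffOn (𝓡 4) ((𝓡 4).prod 𝓘(ℝ, Literature.Geometry.Lorentzian.E4)) ((⊤ : ℕ∞) : WithTop ℕ∞) (fun x ↦ (Bundle.TotalSpace.mk' Literature.Geometry.Lorentzian.E4 x (K x) : TangentBundle (𝓡 4) 𝓑.carrier)) U → (∀ x ∈ U, ∀ v w : TangentSpace (𝓡 4) x, 𝓑.metric.val x (𝓑.metric.leviCivita K x v) w + 𝓑.metric.val x v (𝓑.metric.leviCivita K x w) = 0) → (∀ x ∈ U, VectorField.mlieBracket (𝓡 4) 𝓑.killing K x = 0) → (∀ p ∈ 𝓑.horizon, K p ≠ 0) → (∀ γ : ℝ → 𝓑.carrier, IsMIntegralCurve γ K → γ 0 ∈ 𝓑.horizon → ∀ t, γ t ∈ 𝓑.horizon) → (∀ x ∈ U ∩ 𝓑.doc, 𝓑.metric.val x (K x) (K x) < 0) → (∃ S₀ : Set 𝓑.carrier, IsCompact S₀ ∧ S₀ ⊆ 𝓑.doc ∧ ∀ y ∈ 𝓑.doc, 0 ≤ 𝓑.metric.val y (𝓑.killing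 y) (𝓑.killing y) → y ∉ U → y ∈ Literature.Geometry.Lorentzian.stationaryOrbit 𝓑.killing S₀) → ∀ S : Set 𝓑.carrier, IsCompact S → S ⊆ 𝓑.doc → ∃ (W : Set 𝓑.carrier) (F : 𝓑.carrier → ℝ), IsOpen W ∧ Literature.Geometry.Lorentzian.stationaryOrbit 𝓑.killing S ⊆ W ∧ ContMDiffOn (𝓡 4) 𝓘(ℝ, ℝ) 2 F W ∧ (∀ σ : ℝ → 𝓑.carrier, IsMIntegralCurve σ 𝓑.killing → σ 0 ∈ W → ∀ t, F (σ t) = F (σ 0)) ∧ ∀ x ∈ S, ∀ k : TangentSpace (𝓡 4) x, 𝓑.metric.val x k k = 0 → 𝓑.metric.val x k (𝓑.killing x) = 0 → k ≠ 0 → 0 < 𝓑.metric.toPseudoRiemannianMetric.hessian F x k k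

/-- UNT_tel: no telescope hole has a zero-energy null geodesic trapped modulo the stationary flow. -/
def UniversalNonTrappingModT : Prop :=
  ∀ (𝓑 : Literature.Geometry.Lorentzian.StationaryAFBlackHole.{0}) [𝓑.metric.HasLeviCivita] [Literature.Geometry.Lorentzian.Kerr.Facts], 𝓑.metric.toPseudoRiemannianMetric.IsRicciFlat → 𝓑.IsIPlusRegular → (∀ p : 𝓑.carrier, p ∈ 𝓑.metric.chronologicalFuture 𝓑.timeOrientation 𝓑.Mext) → (∀ p ∈ 𝓑.doc, 𝓑.killing p ≠ 0) → SimplyConnectedSpace 𝓑.doc → ∀ (U : Set 𝓑.carrier) (K : Π x : 𝓑.carrier, TangentSpace (𝓡 4) x), IsOpen U → 𝓑.horizon ⊆ U → IsConnected 𝓑.horizon → ContMDiffOn (𝓡 4) ((𝓡 4).prod 𝓘(ℝ, Literature.Geometry.Lorentzian.E4)) ((⊤ : ℕ∞) : WithTop ℕ∞) (fun x ↦ (Bundle.TotalSpace.mk' Literature.Geometry.Lorentzian.E4 x (K x) : TangentBundle (𝓡 4) 𝓑.carrier)) U → (∀ x ∈ U, ∀ v w : TangentSpace (𝓡 4) x,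 𝓑.metric.val x (𝓑.metric.leviCivita K x v) w + 𝓑.metric.val x v (𝓑.metric.leviCivita K x w) = 0) → (∀ x ∈ U, VectorField.mlieBracket (𝓡 4) 𝓑.killing K x = 0) → (∀ p ∈ 𝓑.horizon, K p ≠ 0) → (∀ γ : ℝ → 𝓑.carrier, IsMIntegralCurve γ K → γ 0 ∈ 𝓑.horizon → ∀ t, γ t ∈ 𝓑.horizon) → (∀ x ∈ U ∩ 𝓑.doc, 𝓑.metric.val x (K x) (K x) < 0) → (∃ S₀ : Set 𝓑.carrier, IsCompact S₀ ∧ S₀ ⊆ 𝓑.doc ∧ ∀ y ∈ 𝓑.doc, 0 ≤ 𝓑.metric.val y (𝓑.killing y) (𝓑.killing y) → y ∉ U → y ∈ Literature.Geometry.Lorentzian.stationaryOrbit 𝓑.killing S₀) → ¬ 𝓑.HasZeroEnergyRayTrappedModFlow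

/-- crux ⇐ UNT_tel (vacuity of the antecedent), by currying over `Negative.ergoregionBombModT_iff`. -/
theorem ErgoregionBombModT_of_UNT (h : UniversalNonTrappingModT) :
    Summit.FinalStateConjecture.FinalStateConjecture.Theses.ZeroEnergyKerrOrBomb.ErgoregionBombModT :=
  Summit.FinalStateConjecture.FinalStateConjecture.Theorems.ErgoregionBombModT.Negative.ergoregionBombModT_iff.2
    fun 𝓑 _ _ h1 h2 h3 h4 h5 U K hU hHU hc hK hKi hbr hK0 htan htl hbelt htrap ↦
      absurd htrap (h 𝓑 h1 h2 h3 h4 h5 U K hU hHU hc hK hKi hbr hK0 htan htl hbelt)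

/-- ZF₀ ⇒ UNT_tel, from the landed certificate `nonTrapping_of_nullConvexFunction` (p164569) and the unfolding lemma
`not_hasZeroEnergyRayTrappedModFlow_iff`. -/
theorem universalNonTrappingModT_of_ZF0 (hZF : ZF0) : UniversalNonTrappingModT :=
  fun 𝓑 _ _ h1 h2 h3 h4 h5 U K hU hHU hc hK hKi hbr hK0 htan htl hbelt ↦
    (StationaryAFBlackHole.not_hasZeroEnergyRayTrappedModFlow_iff 𝓑).2
      (Summit.FinalStateConjecture.FinalStateConjecture.Theorems.ErgoregionBombModT.nonTrapping_of_nullConvexFunction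
        hZF 𝓑 h1 h2 h3 h4 h5 U K hU hHU hc hK hKi hbr hK0 htan htl hbelt)

/-- Hence crux ⇐ ZF₀ factors through UNT_tel (the same content as the landed p163760 composition). -/
example (hZF : ZF0) : Summit.FinalStateConjecture.FinalStateConjecture.Theses.ZeroEnergyKerrOrBomb.ErgoregionBombModT :=
  ErgoregionBombModT_of_UNT (universalNonTrappingModT_of_ZF0 hZF)

end Summit.FinalStateConjecture.FinalStateConjecture.Cruxes.ErgoregionBombModT.ZeroEnergyEscape

end
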